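import Summits.AtomisticToContinuum.Crystallization.Theorems.ChartedZeroExcessLayeredLatticeLiouvilleYE

/-!
# Charted zero-excess layered-lattice Liouville — YG «MildWildCut» (lens-2 g64; docket `stmt-AtomisticToContinuum-26636`)

Sequel of part YE («SereneCut», g62); independent of the pending part YF («EnclosureCut», g63) and COMPATIBLE with it (YG-4).  Column of record:
`gap_and_pert_1_50_of_certs_16XH23B` (part YE), B-body leaves [I_D] ∧ [SBHSᵇ(1/100, 1/20, 8, 16)] ∧ [TBISᵇ(8)](1/100, 1/200, 1/20).

* **THE CUT (structural dichotomy, special vs generic) — BY STRAIN AMPLITUDE, AT THE PERTURBATIVE RADIUS.**  A `ϑ`-hot site `x` (`ϑ = tameRadius = 1/20`: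
  the star's bond vectors miss every rotated model star by more than `1/20`) is either MILD-BALLED at level `ϑp > ϑ` and radius `rp` (`IsTameBall ϑp rp`:
  every star within `rp` of `x` is `ϑp`-tame — the hot network around `x` lives ENTIRELY inside the amplitude window `(ϑ, ϑp]`, where the configuration is
  still a small perturbation of a rotated chart) or it has a `ϑp`-WILD site within `rp` (a star that fits NO rotated model star within `ϑp`).  Exact cover
  by excluded middle on `IsTameBall ϑp rp x` (`hotCount_le_farWarm_add_hotNear`, `sereneBareHotCount_le_mild_add_hotNear`, PROVED); the second class is
  CHARGED to the wild sites of `win (R + rp)` by part YE's packing lemma (`hotNearCount_le_packing_mul_hotCount`).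
* **KERNELS (PROVED).**  «AMPLITUDE LADDER STEP» `hotSparseBPG_of_farWarm_hot : [FWSᵇ](ϑ, ϑp, rp) ∧ [HSᵇ](ϑp) ⇒ [HSᵇ](ϑ)` (`aHi ≤ 8/7`, `rp ≥ 0`, ANY
  `ϑ, ϑp`); its serene refinement `sereneBareHotSparseBPG_of_mild_hot : [MSBHSᵇ](ϑ, ϑp, rp) ∧ [HSᵇ](ϑp) ⇒ [SBHSᵇ](ϑ)`; the TOP RUNG IS A THEOREM
  `hotSparseBPG_of_twelve_le : 12 ≤ ϑ ⇒ [HSᵇ](ϑ)` (every star of a registered window is `12`-tame, part UC `isTameStar_twelve_of_globalReg`); the finite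
  LADDER `hotSparseBPG_of_ladder : (∀ k < n, [FWSᵇ](ϑₖ, ϑₖ₊₁, rₖ)) ∧ 12 ≤ ϑₙ ⇒ [HSᵇ](ϑ₀)` — THE WHOLE HOT-SITE RESIDUAL IS EQUIVALENT-IN-EFFECT TO FINITELY
  MANY FAR-WARM LEAVES ALONG AN AMPLITUDE LADDER, i.e. to (M,K)-type statements «sites with a ϑₖ₊₁-TAME BALL and a ϑₖ-hot star are `o(η)`-sparse», each
  about configurations UNIFORMLY tame on a ball at the next level.
* **[WHSᵇ](ϑp) := `HotSparseBPG ϑp` — WILD STARS ARE `o(η)`-SPARSE (generic side; part YD's leaf AT A HIGHER LEVEL).**  Certified WEAKER than the docket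
  of record for `ϑp ≥ ϑ` (`HotSparseBPG.of_le` + part YE's chain: `hotSparseBPG_of_serene_record`, PROVED); a DIAL WITH BOTH ENDS KNOWN: at `ϑp = 1/20` it is
  [HSᵇ] of record, at `ϑp ≥ 12` it is a THEOREM; in between it weakens monotonically (`HotSparseBPG.of_le`).  MECHANISM (IDEA-NAMED, non-perturbative,
  ENERGY-ONLY): a COARSE GÅRDING INEQUALITY at wild amplitude «`c(ϑp)·#{ϑp-wild sites of a clean chunk C} ≤ Σ_{x ∈ C} (e_x − e⋆) + C·#∂C`» (= lens-3's roof
  R⋆ `DiscreteBarlowRigidity` RESTRICTED to misfit amplitude `≥ ϑp`, hence WEAKER than R⋆; its finite core is the HOMOGENEOUS clean-class gap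
  `min {W_CB(A·H) − e⋆ : A clean, dist(A, SO(3)) ≥ κ(ϑp)} > 0`, interval-certifiable) plus the e⋆-GSC SURFACE BUDGET `Σ_{win R} (e_x − e⋆) ≤ C·R²` gives
  `#wild(win R) = O(R²) = o(η)·nK(win R)` at `R ≥ R₁(η)`.  Honest residual inside: ROUGH wild stars (strain oscillation `≳ κ` within one star radius), where no
  cell is coherently strained and the cellwise route meets `Literature.Barriers.AtomisticToContinuum.LocalizedPotentialsExcludeLennardJones`.
  UNDECIDED · INSTRUMENTABLE («WildScan(ϑp)»: the amplitude histogram of hot stars per `η` in relaxed defected / strained e⋆-windows — in the CLEAN class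
  (no dislocation cores) the prediction is `∅` above `ϑp ≈ 1/8`; «CleanClassGap(κ)»: interval lower bound of `W_CB − e⋆` off `SO(3)`).
* **[MSBHSᵇ](ϑc, ϑ, ϑp, r, ra, rp, …) := `MildSereneBareHotSparseBPG` — MILD-BALLED SERENE BARE HOT SITES ARE `o(η)`-SPARSE (special side).**  Certified
  WEAKER than [SBHSᵇ] (sub-count, `mildSereneBareHotSparseBPG_of_serene`) AND than [FWSᵇ](ϑ, ϑp, rp) (sub-count, `…_of_farWarm`), hence implied by
  [TBISᵇ(rp)](ϑ₁ ≤ ϑ, ω₁, ϑp) (`…_of_tameBallIncoherence`) and by the (M,K)-ball currency (MKᵇᵃˡˡ)(ϑp, rp) (`…_of_tameBallTiltStrain`) — all PROVED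
  seams.  So the special class costs EXACTLY «the (M,K)-currency one amplitude level up»: reverse-Hölder / higher integrability of the strain and tilt
  rigidity on balls that are UNIFORMLY `ϑp`-tame — PERTURBATIVE (linearisation about the rotated chart with cubic remainder `≈ 6.4·ε` of the quadratic
  term at bond strain `ε`, absorbed by the chart's coercivity margin) exactly as long as `ϑp` lies inside the linear-stability radius of the chart family
  (part TP (U♮ᴱ) docstring: bond stiffness moves ≈ 20 % per 1 % bond strain against a ≈ 15 % relative phonon margin).  TWO typed lines: (α) the seams
  above; (β) part YF's enclosure door with a MILD core (small-data uniqueness by the inverse-function theorem on the clamped problem — E–Ming 2007,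
  Ortner–Theil 2013, Braun–Schmidt 2016 — valid precisely in the mild class).  ATTACKABLE·M · INSTRUMENTABLE («MildMargin(ϑp)»: the coercivity margin of the
  linearised clamped operator along clean states of bond strain `≤ ϑp/4`).
* **THE DIAL `ϑp` MOVES CONTENT ACROSS THE CUT (PROVED dial lemmas).**  `ϑp ↑`: [WHSᵇ](ϑp) WEAKER (`HotSparseBPG.of_le`), [MSBHSᵇ](ϑp) STRONGER
  (`MildSereneBareHotSparseBPG.anti_level`), (MKᵇᵃˡˡ)(ϑp) less perturbative; `rp ↑`: [MSBHSᵇ] WEAKER (`….of_rp_le`), charging constant `(2rp/δ+1)³` larger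
  (harmless: `o(η)`).  The DECISION NUMBER is the crossing of two census curves: the largest `ϑp` with a certified (U♮)-type margin («MildMargin») against
  the smallest `ϑp` above which «WildScan» is empty in the clean class.  If they cross (margin radius ≥ clean wild ceiling) the hot-site residual of 26636 is
  PURE (M,K)-CURRENCY; if not, the gap between them is the precisely located non-perturbative residual [WHSᵇ](ϑp⋆).
* **COLUMNS.**  `_16XH25B` (CONSERVATIVE, 25 binders) = `_16XH23B` with [SBHSᵇ] replaced by [MSBHSᵇ](1/100, 1/20, 1/10, 8, 16, 24) ∧ [WHSᵇ](1/10) — BOTH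
  certified WEAKER than the docket of record.  `_16XH25BL` (LADDER, 23 binders) = the twenty generic leaves + [TBISᵇ(8)](1/100, 1/200, 1/20) ∧
  [TBISᵇ(24)](1/100, 1/200, 1/10) ∧ [WHSᵇ](1/10) + `PeriodicBulkGapDoor 2`: NO dressing leaf [I_D], NO serenity — «the dressing/serenity apparatus of parts
  UG–YE is, in effect, ONE more (M,K)-ball leaf at double amplitude plus wild sparsity»; here [TBISᵇ(24)](…, 1/10) is SIDEWAYS (not implied by the record:
  the (M,K)-currency at level `1/10`, TRUE-type iff `1/10` is inside the stability radius), the other two are in / weaker than the record.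
* **COMPATIBILITY WITH PART YF (g63).**  The two cuts are ORTHOGONAL sub-count partitions of the same serene count: YF's isolation/burial conjuncts and YG's
  `IsTameBall ϑp rp` conjunct commute, and for `rp ≥ q + ρ = 20` a mild-balled isolated site has a MILD clamped core, so YF's door [CMCᶜ] is needed only
  in its MILD form (extra hypothesis `IsTameOn ϑp S H (coreOf S K ρ)`, WEAKER) — the perturbative small-data uniqueness — while wild cores go to [WHSᵇ].
WHY THIS IS NOVEL.  Parts UC–YF cut hot sites by collar, connectivity, profile, dressing, serenity, isolation and burial — all at ONE amplitude `ϑ = 1/20`;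
lens-3's «AmplitudeCut» (GEN 18) cuts N at LAW level by the SUP window-misfit amplitude `ν₀` (GAP/PERT).  Part YG cuts the deterministic B-body COUNT by the
SITEWISE star-strain amplitude of the surrounding ball, re-roots the hot residual on an amplitude LADDER whose top is a theorem, and identifies the special
side with an EXISTING currency one level up (four proved seams), so that the only new leaf of the conservative column is part YD's [HSᵇ] at a higher level.
WHY EACH PIECE IS STRICTLY WEAKER / WHERE IT SITS.  [MSBHSᵇ] ⟸ [SBHSᵇ] and ⟸ [FWSᵇ](ϑ, ϑp, rp) ⟸ [TBISᵇ(rp)](ϑp) ⟸ (MKᵇᵃˡˡ)(ϑp, rp); [WHSᵇ](ϑp) ⟸ [HSᵇ](ϑ) ⟸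
[I_D] ∧ [SBHSᵇ] ∧ [TBISᵇ(8)] (ϑ ≤ ϑp); neither piece alone gives [SBHSᵇ] (a fat mild lump is counted only left, a wild filament only right).
No sorry, no new axiom, no instances / notations / option overrides; classical indicators via `open scoped Classical` (parts YC–YF precedent).
-/

noncomputable section

open scoped BigOperators Classical
open MeasureTheory Set Metric Filter Topology
open Summit.AtomisticToContinuum.Crystallization.Theorems.ChartedPlanarOrderRigidityDoor (E3 atomsIn VisibleGap PertRegime)
open Summit.AtomisticToContinuum.Crystallization.Theorems.ChartedPlanarOrderDensityDichotomy (μS IsSep nK nK_nonneg)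
open Summit.AtomisticToContinuum.Crystallization.Theorems.ChartedPlanarOrderCleanScaleP (IsCleanP IsDoorSetP)
open Summit.AtomisticToContinuum.Crystallization.Theorems.ChartedPlanarOrderMesoCut (LayeredHom EnvClose)
open Summit.AtomisticToContinuum.Crystallization.Theorems.ChartedPlanarOrderDoorLayered (atomsIn_subset sq_le_finsum_mem PeriodicBulkGapDoor)
open Summit.AtomisticToContinuum.Crystallization.Theorems.ChartedPlanarOrderDoorLayeredOsc (IsTwoShellAffineGood)
open Literature.MathematicalPhysics.StatisticalMechanics (card_le_of_separated_of_dist_le)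

namespace Summit.AtomisticToContinuum.Crystallization.Theorems.ChartedZeroExcessLayeredLatticeLiouville

/-! ### YG-1  The hot count re-rooted by AMPLITUDE: antitonicity, the excluded middle on mild balls, the ladder step, the top rung, the ladder -/

/-- `hotCount` is ANTITONE in the level: a `ϑ`-tame star is `ϑ'`-tame for `ϑ ≤ ϑ'` (part UC `IsTameStar.mono`). [this file, g64] -/
theorem hotCount_anti {ϑ ϑ' : ℝ} {S H Q : Set E3} (hQ : Q.Finite) (hle : ϑ ≤ ϑ') : hotCount ϑ' S H Q ≤ hotCount ϑ S H Q := by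
  rw [hotCount, hotCount, finsum_mem_eq_finite_toFinset_sum _ hQ, finsum_mem_eq_finite_toFinset_sum _ hQ]
  refine Finset.sum_le_sum fun x _ => ?_
  by_cases ht : IsTameStar ϑ S H x
  · rw [if_pos ht, if_pos (ht.mono hle)]
  · rw [if_neg ht]
    split_ifs <;> norm_num

/-- ★ **DIAL (PROVED): [HSᵇ] is WEAKER at a higher level** — `[HSᵇ](ϑ) ⇒ [HSᵇ](ϑ')` for `ϑ ≤ ϑ'`. [this file, g64] -/
theorem HotSparseBPG.of_le {ϑ ϑ' aHi Λ θ s : ℝ} (hle : ϑ ≤ ϑ') (h : HotSparseBPG ϑ aHi Λ θ s) : HotSparseBPG ϑ' aHi Λ θ s :=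
  hotSparseBPG_iff_count.2 (CountSparseBPG.of_pointwise_le (fun _ _ _ _ hQ _ _ => hotCount_anti hQ hle) (hotSparseBPG_iff_count.1 h))

/-- `IsTameBall` is monotone in the level. [formal bookkeeping] -/
theorem IsTameBall.mono_level {ϑ ϑ' r : ℝ} (hle : ϑ ≤ ϑ') {S H : Set E3} {x : E3} (h : IsTameBall ϑ r S H x) : IsTameBall ϑ' r S H x :=
  fun y hy hyx => (h y hy hyx).mono hle

/-- `IsTameBall` is antitone in the radius. [formal bookkeeping] -/
theorem IsTameBall.anti_radius {ϑ r r' : ℝ} (hle : r ≤ r') {S H : Set E3} {x : E3} (h : IsTameBall ϑ r' S H x) : IsTameBall ϑ r S H x :=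
  fun y hy hyx => h y hy (hyx.trans hle)

/-- ★★ **THE AMPLITUDE CUT OF THE HOT COUNT (PROVED, exact cover)**: `hotCount ϑ ≤ farWarmCount ϑ ϑp rp + hotNearCount ϑp rp` — a `ϑ`-hot site either has a
`ϑp`-tame `rp`-ball (then it is FAR-WARM at levels `(ϑ, ϑp, rp)`: part YE's `IsFarWarm` with `ϑc ↦ ϑ`, `ϑ ↦ ϑp`, `r ↦ rp`) or a `ϑp`-WILD site within `rp`. [this file, g64] -/
theorem hotCount_le_farWarm_add_hotNear {ϑ ϑp rp : ℝ} {S H Q : Set E3} (hQ : Q.Finite) :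
    hotCount ϑ S H Q ≤ farWarmCount ϑ ϑp rp S H Q + hotNearCount ϑp rp S H Q := by
  rw [hotCount, farWarmCount, hotNearCount, finsum_mem_eq_finite_toFinset_sum _ hQ, finsum_mem_eq_finite_toFinset_sum _ hQ,
    finsum_mem_eq_finite_toFinset_sum _ hQ, ← Finset.sum_add_distrib]
  refine Finset.sum_le_sum fun x _ => ?_
  have hf : (0 : ℝ) ≤ (if IsFarWarm ϑ ϑp rp S H x then (1 : ℝ) else 0) := by split_ifs <;> norm_num
  have hn : (0 : ℝ) ≤ (if (∃ y ∈ S, dist y x ≤ rp ∧ ¬ IsTameStar ϑp S H y) then (1 : ℝ) else 0) := by split_ifs <;> norm_num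
  by_cases ht : IsTameStar ϑ S H x
  · rw [if_pos ht]
    exact add_nonneg hf hn
  · rw [if_neg ht]
    by_cases hb : IsTameBall ϑp rp S H x
    · rw [if_pos (show IsFarWarm ϑ ϑp rp S H x from ⟨hb, ht⟩)]
      linarith
    · rw [if_pos (exists_hot_of_not_isTameBall hb)]
      linarith

/-- ★★★ **AMPLITUDE LADDER STEP (PROVED): [FWSᵇ](ϑ, ϑp, rp) ∧ [HSᵇ](ϑp) ⇒ [HSᵇ](ϑ)** on `aHi ≤ 8/7` door sets, `rp ≥ 0`, for ANY levels `ϑ, ϑp` — the sites with a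
wild `rp`-neighbour are charged to the wild sites of `win (R + rp)` through part YE's charging glue. [this file, g64] -/
theorem hotSparseBPG_of_farWarm_hot {ϑ ϑp rp aHi Λ θ s : ℝ} (haHi : aHi ≤ 8 / 7) (hrp : 0 ≤ rp)
    (hF : FarWarmSparseBPG ϑ ϑp rp aHi Λ θ s) (hW : HotSparseBPG ϑp aHi Λ θ s) : HotSparseBPG ϑ aHi Λ θ s :=
  hotSparseBPG_iff_count.2
    (CountSparseBPG.of_le_add_mul (cntA := fun S H _ Q => hotCount ϑ S H Q)
      (cntB := fun S H _ Q => farWarmCount ϑ ϑp rp S H Q) (cntC := fun S H _ Q => hotCount ϑp S H Q)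
      (C := fun δ => (2 * rp / δ + 1) ^ 3) haHi (fun δ _ => by positivity)
      (fun δ hδ S hsep H Ψ R => (hotCount_le_farWarm_add_hotNear (finite_atomsIn hδ hsep R)).trans
        (add_le_add le_rfl (hotNearCount_le_packing_mul_hotCount hδ hsep hrp H)))
      (fun _ _ _ _ _ hQ' hQQ' => hotCount_mono hQ' hQQ') hF (hotSparseBPG_iff_count.1 hW))

/-- under a global registration every star is `12`-tame (part UC), so the hot count VANISHES at every level `ϑ ≥ 12`. [this file, g64] -/
theorem hotCount_eq_zero_of_globalReg {ϑ Cg η R : ℝ} (hϑ : 12 ≤ ϑ) {S H : Set E3} {Ψ : E3 → E3} (hΨ : IsGlobalReg Cg η R S H Ψ) {Q : Set E3} (hQS : Q ⊆ S) :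
    hotCount ϑ S H Q = 0 :=
  hotCount_eq_zero_of_isTameOn (K := S) (fun _ hx => (isTameStar_twelve_of_globalReg hΨ hx).mono hϑ) hQS

/-- ★ **TOP RUNG (PROVED): [HSᵇ](ϑ) HOLDS for `ϑ ≥ 12`** — the wild leaf's dial ends in a theorem. [this file, g64] -/
theorem hotSparseBPG_of_twelve_le {ϑ aHi Λ θ s : ℝ} (hϑ : 12 ≤ ϑ) : HotSparseBPG ϑ aHi Λ θ s := by
  intro δ hδ a ha Cg hCg εw hεw K₀ hK₀
  refine ⟨1, one_pos, 1, one_pos, fun S hS hgood η hη hηle R hR L w hLw Ψ hΨ hBI hfat => ?_⟩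
  rw [hotCount_eq_zero_of_globalReg hϑ hΨ (atomsIn_subset S R)]
  exact mul_nonneg (mul_nonneg hεw.le hη.le) (nK_nonneg _)

/-- ★★ **THE AMPLITUDE LADDER (PROVED)**: for levels `ϑ₀, ϑ₁, …, ϑₙ` with `ϑₙ ≥ 12` and radii `rₖ ≥ 0`, the far-warm leaves `[FWSᵇ](ϑₖ, ϑₖ₊₁, rₖ)`, `k < n`,
give `[HSᵇ](ϑ₀)` — the WHOLE hot-site residual is finitely many statements about sites WITH A TAME BALL one level up. [this file, g64] -/
theorem hotSparseBPG_of_ladder {aHi Λ θ s : ℝ} (haHi : aHi ≤ 8 / 7) (ϑ r : ℕ → ℝ) (n : ℕ) (hr : ∀ k, 0 ≤ r k) (htop : 12 ≤ ϑ n)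
    (h : ∀ k, k < n → FarWarmSparseBPG (ϑ k) (ϑ (k + 1)) (r k) aHi Λ θ s) : HotSparseBPG (ϑ 0) aHi Λ θ s := by
  suffices hlad : ∀ m, m ≤ n → HotSparseBPG (ϑ (n - m)) aHi Λ θ s by
    have h0 := hlad n le_rfl
    rwa [Nat.sub_self] at h0
  intro m
  induction m with
  | zero =>
      intro _
      rw [Nat.sub_zero]
      exact hotSparseBPG_of_twelve_le htop
  | succ m ih =>
      intro hm
      have hstep := h (n - (m + 1)) (by omega)
      have heq : n - (m + 1) + 1 = n - m := by omega
      rw [heq] at hstep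
      exact hotSparseBPG_of_farWarm_hot haHi (hr _) hstep (ih (by omega))

/-! ### YG-2  The serene refinement: MILD-BALLED serene bare hot sites, the leaf [MSBHSᵇ], the glue, the four certificates, the dials -/

/-- number of MILD-BALLED SERENE BARE HOT sites of `Q`: not dressed, not `ϑ`-tame, not agitated, AND with a `ϑp`-tame `rp`-ball (the whole hot network within
`rp` lives in the amplitude window `(ϑ, ϑp]`). [this file, g64] -/
def mildSereneBareHotCount (ϑc ϑ ϑp r ra rp ϑe ωe : ℝ) (p : ℕ) (r₀ ℓ : ℝ) (M : ℕ) (S H Q : Set E3) : ℝ :=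
  ∑ᶠ x ∈ Q, if IsDressed ϑe ωe p r₀ ℓ M S H x ∨ IsTameStar ϑ S H x ∨ IsAgitated ϑc ϑ r ra S H x ∨ ¬ IsTameBall ϑp rp S H x then (0 : ℝ) else 1

/-- `mildSereneBareHotCount_nonneg`. [formal bookkeeping] -/
theorem mildSereneBareHotCount_nonneg (ϑc ϑ ϑp r ra rp ϑe ωe : ℝ) (p : ℕ) (r₀ ℓ : ℝ) (M : ℕ) (S H Q : Set E3) :
    0 ≤ mildSereneBareHotCount ϑc ϑ ϑp r ra rp ϑe ωe p r₀ ℓ M S H Q :=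
  finsum_nonneg fun x => finsum_nonneg fun _ => by split_ifs <;> norm_num

/-- ★★ **THE AMPLITUDE CUT OF THE SERENE COUNT (PROVED, exact cover)**: `sereneBareHotCount ≤ mildSereneBareHotCount + hotNearCount ϑp rp`. [this file, g64] -/
theorem sereneBareHotCount_le_mild_add_hotNear {ϑc ϑ ϑp r ra rp ϑe ωe : ℝ} {p : ℕ} {r₀ ℓ : ℝ} {M : ℕ} {S H Q : Set E3} (hQ : Q.Finite) :
    sereneBareHotCount ϑc ϑ r ra ϑe ωe p r₀ ℓ M S H Q
      ≤ mildSereneBareHotCount ϑc ϑ ϑp r ra rp ϑe ωe p r₀ ℓ M S H Q + hotNearCount ϑp rp S H Q := by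
  rw [sereneBareHotCount, mildSereneBareHotCount, hotNearCount, finsum_mem_eq_finite_toFinset_sum _ hQ, finsum_mem_eq_finite_toFinset_sum _ hQ,
    finsum_mem_eq_finite_toFinset_sum _ hQ, ← Finset.sum_add_distrib]
  refine Finset.sum_le_sum fun x _ => ?_
  have hm : (0 : ℝ) ≤ (if IsDressed ϑe ωe p r₀ ℓ M S H x ∨ IsTameStar ϑ S H x ∨ IsAgitated ϑc ϑ r ra S H x ∨ ¬ IsTameBall ϑp rp S H x
      then (0 : ℝ) else 1) := by
    split_ifs <;> norm_num
  have hn : (0 : ℝ) ≤ (if (∃ y ∈ S, dist y x ≤ rp ∧ ¬ IsTameStar ϑp S H y) then (1 : ℝ) else 0) := by split_ifs <;> norm_num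
  by_cases hA : IsDressed ϑe ωe p r₀ ℓ M S H x ∨ IsTameStar ϑ S H x ∨ IsAgitated ϑc ϑ r ra S H x
  · rw [if_pos hA]
    exact add_nonneg hm hn
  · rw [if_neg hA]
    by_cases hb : IsTameBall ϑp rp S H x
    · have hno : ¬ (IsDressed ϑe ωe p r₀ ℓ M S H x ∨ IsTameStar ϑ S H x ∨ IsAgitated ϑc ϑ r ra S H x ∨ ¬ IsTameBall ϑp rp S H x) :=
        fun h' => h'.elim (fun h₁ => hA (Or.inl h₁)) (fun h₂ => h₂.elim (fun h₃ => hA (Or.inr (Or.inl h₃)))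
          (fun h₄ => h₄.elim (fun h₅ => hA (Or.inr (Or.inr h₅))) (fun h₆ => h₆ hb)))
      rw [if_neg hno]
      linarith
    · rw [if_pos (exists_hot_of_not_isTameBall hb)]
      linarith

/-- sub-count (PROVED): mild-balled serene bare hot ⊆ serene bare hot. [this file, g64] -/
theorem mildSereneBareHotCount_le_sereneBareHotCount {ϑc ϑ ϑp r ra rp ϑe ωe : ℝ} {p : ℕ} {r₀ ℓ : ℝ} {M : ℕ} {S H Q : Set E3} (hQ : Q.Finite) :
    mildSereneBareHotCount ϑc ϑ ϑp r ra rp ϑe ωe p r₀ ℓ M S H Q ≤ sereneBareHotCount ϑc ϑ r ra ϑe ωe p r₀ ℓ M S H Q := by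
  rw [mildSereneBareHotCount, sereneBareHotCount, finsum_mem_eq_finite_toFinset_sum _ hQ, finsum_mem_eq_finite_toFinset_sum _ hQ]
  refine Finset.sum_le_sum fun x _ => ?_
  by_cases hA : IsDressed ϑe ωe p r₀ ℓ M S H x ∨ IsTameStar ϑ S H x ∨ IsAgitated ϑc ϑ r ra S H x
  · rw [if_pos hA, if_pos (hA.elim (fun h₁ => Or.inl h₁) (fun h₂ => h₂.elim (fun h₃ => Or.inr (Or.inl h₃)) (fun h₄ => Or.inr (Or.inr (Or.inl h₄)))))]
  · rw [if_neg hA]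
    split_ifs <;> norm_num

/-- sub-count (PROVED): mild-balled serene bare hot ⊆ FAR-WARM at levels `(ϑ, ϑp, rp)` — the special class is paid in part YE's observer currency ONE LEVEL UP.
[this file, g64] -/
theorem mildSereneBareHotCount_le_farWarmCount {ϑc ϑ ϑp r ra rp ϑe ωe : ℝ} {p : ℕ} {r₀ ℓ : ℝ} {M : ℕ} {S H Q : Set E3} (hQ : Q.Finite) :
    mildSereneBareHotCount ϑc ϑ ϑp r ra rp ϑe ωe p r₀ ℓ M S H Q ≤ farWarmCount ϑ ϑp rp S H Q := by
  rw [mildSereneBareHotCount, farWarmCount, finsum_mem_eq_finite_toFinset_sum _ hQ, finsum_mem_eq_finite_toFinset_sum _ hQ]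
  refine Finset.sum_le_sum fun x _ => ?_
  by_cases hm : IsDressed ϑe ωe p r₀ ℓ M S H x ∨ IsTameStar ϑ S H x ∨ IsAgitated ϑc ϑ r ra S H x ∨ ¬ IsTameBall ϑp rp S H x
  · rw [if_pos hm]
    split_ifs <;> norm_num
  · rw [if_neg hm]
    have hb : IsTameBall ϑp rp S H x := by
      by_contra hb
      exact hm (Or.inr (Or.inr (Or.inr hb)))
    have hfw : IsFarWarm ϑ ϑp rp S H x := ⟨hb, fun ht => hm (Or.inr (Or.inl ht))⟩
    rw [if_pos hfw]

/-- ★★ **[MSBHSᵇ] «MildSereneBareHotSparseBPG ϑc ϑ ϑp r ra rp ϑe ωe p r₀ ℓ M aHi Λ θ s» — MILD-BALLED SERENE BARE HOT SITES ARE `o(η)`-SPARSE** (the SPECIAL class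
of the lens-2 amplitude cut of [SBHSᵇ]): with the B-body's binders, the sites of `win R` that are bare, `ϑ`-hot, serene at `(ϑc, r, ra)` AND whose `rp`-ball is
`ϑp`-TAME (the hot network around them is MILD: every star within `rp` fits a rotated model star within `ϑp`) number `≤ εw·η·nK(win R)`.  WEAKER than [SBHSᵇ]
(sub-count) and than [FWSᵇ](ϑ, ϑp, rp) (sub-count), hence than [TBISᵇ(rp)](ϑ₁ ≤ ϑ, ω₁, ϑp) and (MKᵇᵃˡˡ)(ϑp, rp) (all PROVED below): its whole content is the
(M,K)-currency — higher integrability of the strain, tilt rigidity — on balls that are UNIFORMLY `ϑp`-tame, i.e. linearisation about a rotated chart with bond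
strain `≤ ϑp/4`.  PERTURBATIVE iff `ϑp` lies inside the linear-stability radius of the clean chart family.  SPECIAL · WEAKER (two certificates) · ATTACKABLE·M
((α) the seams; (β) part YF's enclosure door with a mild core = small-data uniqueness by IFT on the clamped problem) · INSTRUMENTABLE («MildMargin(ϑp)»).
Why it might fail: only through its implicants — `ϑp = 1/10` (bond strain ≈ 2.5 %) may already be OUTSIDE the certified coercivity margin of the linearised
operator (stiffness drift ≈ 50 % against a ≈ 15 % margin), in which case (MKᵇᵃˡˡ)(1/10, 24) is no longer perturbative and fat mild lumps (vacuously serene,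
strain uniformly in `(1.25 %, 2.5 %]` over radius `> 40`) at volume fraction `≍ η` would be the counterexample texture; none known in e⋆-GSC door sets.
Sources: part YE ([SBHSᵇ], [FWSᵇ], [TBISᵇ(r)], (MKᵇᵃˡˡ)); part TP ((U♮ᴱ)); E–Ming, Arch. Ration. Mech. Anal. 183 (2007) 241; Ortner–Theil, Arch. Ration. Mech.
Anal. 207 (2013) 1025; Braun–Schmidt, arXiv 1604.00197; Ehrlacher–Ortner–Shapeev, Arch. Ration. Mech. Anal. 222 (2016) 1217. [this file, g64] -/
def MildSereneBareHotSparseBPG (ϑc ϑ ϑp r ra rp ϑe ωe : ℝ) (p : ℕ) (r₀ ℓ : ℝ) (M : ℕ) (aHi Λ θ s : ℝ) : Prop :=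
  CountSparseBPG (fun S H _ Q => mildSereneBareHotCount ϑc ϑ ϑp r ra rp ϑe ωe p r₀ ℓ M S H Q) aHi Λ θ s

/-- ★★★ **GLUE (PROVED): [MSBHSᵇ](ϑ, ϑp, rp) ∧ [HSᵇ](ϑp) ⇒ [SBHSᵇ](ϑ)** on `aHi ≤ 8/7` door sets, `rp ≥ 0` — the serene bare hot sites with a wild
`rp`-neighbour are charged to the `ϑp`-wild sites of `win (R + rp)`. [this file, g64] -/
theorem sereneBareHotSparseBPG_of_mild_hot {ϑc ϑ ϑp r ra rp ϑe ωe : ℝ} {p : ℕ} {r₀ ℓ : ℝ} {M : ℕ} {aHi Λ θ s : ℝ} (haHi : aHi ≤ 8 / 7) (hrp : 0 ≤ rp)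
    (hM : MildSereneBareHotSparseBPG ϑc ϑ ϑp r ra rp ϑe ωe p r₀ ℓ M aHi Λ θ s) (hW : HotSparseBPG ϑp aHi Λ θ s) :
    SereneBareHotSparseBPG ϑc ϑ r ra ϑe ωe p r₀ ℓ M aHi Λ θ s :=
  CountSparseBPG.of_le_add_mul (cntA := fun S H _ Q => sereneBareHotCount ϑc ϑ r ra ϑe ωe p r₀ ℓ M S H Q)
    (cntB := fun S H _ Q => mildSereneBareHotCount ϑc ϑ ϑp r ra rp ϑe ωe p r₀ ℓ M S H Q) (cntC := fun S H _ Q => hotCount ϑp S H Q)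
    (C := fun δ => (2 * rp / δ + 1) ^ 3) haHi (fun δ _ => by positivity)
    (fun δ hδ S hsep H Ψ R => (sereneBareHotCount_le_mild_add_hotNear (finite_atomsIn hδ hsep R)).trans
      (add_le_add le_rfl (hotNearCount_le_packing_mul_hotCount hδ hsep hrp H)))
    (fun _ _ _ _ _ hQ' hQQ' => hotCount_mono hQ' hQQ') hM (hotSparseBPG_iff_count.1 hW)

/-- **CERTIFICATE 1 (PROVED): [SBHSᵇ] ⇒ [MSBHSᵇ]** — the special leaf is WEAKER than the leaf of record (sub-count). [this file, g64] -/
theorem mildSereneBareHotSparseBPG_of_serene {ϑc ϑ ϑp r ra rp ϑe ωe : ℝ} {p : ℕ} {r₀ ℓ : ℝ} {M : ℕ} {aHi Λ θ s : ℝ}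
    (h : SereneBareHotSparseBPG ϑc ϑ r ra ϑe ωe p r₀ ℓ M aHi Λ θ s) : MildSereneBareHotSparseBPG ϑc ϑ ϑp r ra rp ϑe ωe p r₀ ℓ M aHi Λ θ s :=
  CountSparseBPG.of_pointwise_le (fun _ _ _ _ hQ _ _ => mildSereneBareHotCount_le_sereneBareHotCount hQ) h

/-- **CERTIFICATE 2 (PROVED): [FWSᵇ](ϑ, ϑp, rp) ⇒ [MSBHSᵇ]** — the special leaf is WEAKER than part YE's observer leaf ONE LEVEL UP. [this file, g64] -/
theorem mildSereneBareHotSparseBPG_of_farWarm {ϑc ϑ ϑp r ra rp ϑe ωe : ℝ} {p : ℕ} {r₀ ℓ : ℝ} {M : ℕ} {aHi Λ θ s : ℝ}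
    (h : FarWarmSparseBPG ϑ ϑp rp aHi Λ θ s) : MildSereneBareHotSparseBPG ϑc ϑ ϑp r ra rp ϑe ωe p r₀ ℓ M aHi Λ θ s :=
  CountSparseBPG.of_pointwise_le (fun _ _ _ _ hQ _ _ => mildSereneBareHotCount_le_farWarmCount hQ) h

/-- **CERTIFICATE 3 (PROVED): [TBISᵇ(rp)](ϑ₁, ω₁, ϑp) ⇒ [MSBHSᵇ] for `ϑ₁ ≤ ϑ`** — through part YE's `farWarmSparseBPG_of_tameBallIncoherence`. [this file, g64] -/
theorem mildSereneBareHotSparseBPG_of_tameBallIncoherence {ϑ₁ ω₁ ϑc ϑ ϑp r ra rp ϑe ωe : ℝ} {p : ℕ} {r₀ ℓ : ℝ} {M : ℕ} {aHi Λ θ s : ℝ} (hϑ₁ : ϑ₁ ≤ ϑ)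
    (h : TameBallIncoherenceSparseBPG ϑ₁ ω₁ ϑp rp aHi Λ θ s) : MildSereneBareHotSparseBPG ϑc ϑ ϑp r ra rp ϑe ωe p r₀ ℓ M aHi Λ θ s :=
  mildSereneBareHotSparseBPG_of_farWarm (farWarmSparseBPG_of_tameBallIncoherence hϑ₁ h)

/-- **CERTIFICATE 4 (PROVED): (MKᵇᵃˡˡ)(ϑp, rp) ⇒ [MSBHSᵇ] for `ϑ > 0`** — the (M,K)-ball currency one level up (part YE `TameBallTiltStrainBPG`) pays the special
class outright (`ϑ₁ := ϑ`, `ω₁ := 1`). [this file, g64] -/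
theorem mildSereneBareHotSparseBPG_of_tameBallTiltStrain {ϑc ϑ ϑp r ra rp ϑe ωe : ℝ} {p : ℕ} {r₀ ℓ : ℝ} {M : ℕ} {aHi Λ θ s : ℝ} (hϑ : 0 < ϑ)
    (h : TameBallTiltStrainBPG ϑp rp aHi Λ θ s) : MildSereneBareHotSparseBPG ϑc ϑ ϑp r ra rp ϑe ωe p r₀ ℓ M aHi Λ θ s :=
  mildSereneBareHotSparseBPG_of_tameBallIncoherence le_rfl (tameBallIncoherenceSparseBPG_of_tameBallTiltStrain (ω₁ := 1) hϑ one_pos h)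

/-- **CERTIFICATE 5 (PROVED): THE DOCKET OF RECORD ⇒ [WHSᵇ](ϑp) for `ϑ ≤ ϑp`** — [I_D] ∧ [SBHSᵇ](ϑc, ϑ, r, ra) ∧ [TBISᵇ(r)](ϑ₁ ≤ ϑc, ω₁, ϑ) give [HSᵇ](ϑ) (part
YE/YD chain) hence [HSᵇ](ϑp): the wild leaf is WEAKER than the column of record's B-body. [this file, g64] -/
theorem hotSparseBPG_of_serene_record {ϑ₁ ω₁ ϑc ϑ ϑp r ra ϑe ωe : ℝ} {p : ℕ} {r₀ ℓ : ℝ} {M : ℕ} {aHi Λ θ s : ℝ} (haHi : aHi ≤ 8 / 7) (hra : 0 ≤ ra)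
    (hϑ₁ : ϑ₁ ≤ ϑc) (hle : ϑ ≤ ϑp) (hI : DressedCorePG ϑ ϑe ωe p r₀ ℓ M aHi Λ θ s) (hS' : SereneBareHotSparseBPG ϑc ϑ r ra ϑe ωe p r₀ ℓ M aHi Λ θ s)
    (hT : TameBallIncoherenceSparseBPG ϑ₁ ω₁ ϑ r aHi Λ θ s) : HotSparseBPG ϑp aHi Λ θ s :=
  (hotSparseBPG_of_dressedCore_bareHot hI (bareHotSparseBPG_of_serene_tameBallIncoherence haHi hra hϑ₁ hS' hT)).of_le hle

/-- **DIAL (PROVED): [MSBHSᵇ] is WEAKER at a larger mild radius** (`rp ≤ rp'`: fewer sites have a tame `rp'`-ball). [this file, g64] -/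
theorem MildSereneBareHotSparseBPG.of_rp_le {ϑc ϑ ϑp r ra rp rp' ϑe ωe : ℝ} {p : ℕ} {r₀ ℓ : ℝ} {M : ℕ} {aHi Λ θ s : ℝ} (hle : rp ≤ rp')
    (h : MildSereneBareHotSparseBPG ϑc ϑ ϑp r ra rp ϑe ωe p r₀ ℓ M aHi Λ θ s) : MildSereneBareHotSparseBPG ϑc ϑ ϑp r ra rp' ϑe ωe p r₀ ℓ M aHi Λ θ s := by
  refine CountSparseBPG.of_pointwise_le (fun S H _ Q hQ _ _ => ?_) h
  rw [mildSereneBareHotCount, mildSereneBareHotCount, finsum_mem_eq_finite_toFinset_sum _ hQ, finsum_mem_eq_finite_toFinset_sum _ hQ]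
  refine Finset.sum_le_sum fun x _ => ?_
  by_cases hm : IsDressed ϑe ωe p r₀ ℓ M S H x ∨ IsTameStar ϑ S H x ∨ IsAgitated ϑc ϑ r ra S H x ∨ ¬ IsTameBall ϑp rp S H x
  · rw [if_pos hm, if_pos (hm.elim (fun h₁ => Or.inl h₁) (fun h₂ => h₂.elim (fun h₃ => Or.inr (Or.inl h₃))
      (fun h₄ => h₄.elim (fun h₅ => Or.inr (Or.inr (Or.inl h₅))) (fun h₆ => Or.inr (Or.inr (Or.inr (fun hb => h₆ (hb.anti_radius hle))))))))]
  · rw [if_neg hm]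
    split_ifs <;> norm_num

/-- **DIAL (PROVED): [MSBHSᵇ] is WEAKER at a lower mild level** (`ϑp' ≤ ϑp`: fewer sites have a `ϑp'`-tame ball) — the dial `ϑp` moves content ACROSS the cut:
up weakens [WHSᵇ](ϑp) (`HotSparseBPG.of_le`) and strengthens [MSBHSᵇ](ϑp). [this file, g64] -/
theorem MildSereneBareHotSparseBPG.anti_level {ϑc ϑ ϑp ϑp' r ra rp ϑe ωe : ℝ} {p : ℕ} {r₀ ℓ : ℝ} {M : ℕ} {aHi Λ θ s : ℝ} (hle : ϑp' ≤ ϑp)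
    (h : MildSereneBareHotSparseBPG ϑc ϑ ϑp r ra rp ϑe ωe p r₀ ℓ M aHi Λ θ s) : MildSereneBareHotSparseBPG ϑc ϑ ϑp' r ra rp ϑe ωe p r₀ ℓ M aHi Λ θ s := by
  refine CountSparseBPG.of_pointwise_le (fun S H _ Q hQ _ _ => ?_) h
  rw [mildSereneBareHotCount, mildSereneBareHotCount, finsum_mem_eq_finite_toFinset_sum _ hQ, finsum_mem_eq_finite_toFinset_sum _ hQ]
  refine Finset.sum_le_sum fun x _ => ?_
  by_cases hm : IsDressed ϑe ωe p r₀ ℓ M S H x ∨ IsTameStar ϑ S H x ∨ IsAgitated ϑc ϑ r ra S H x ∨ ¬ IsTameBall ϑp rp S H x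
  · rw [if_pos hm, if_pos (hm.elim (fun h₁ => Or.inl h₁) (fun h₂ => h₂.elim (fun h₃ => Or.inr (Or.inl h₃))
      (fun h₄ => h₄.elim (fun h₅ => Or.inr (Or.inr (Or.inl h₅))) (fun h₆ => Or.inr (Or.inr (Or.inr (fun hb => h₆ (hb.mono_level hle))))))))]
  · rw [if_neg hm]
    split_ifs <;> norm_num

/-! ### YG-3  The columns: `_16XH25B` (conservative, both new leaves WEAKER) and `_16XH25BL` (ladder: no dressing, no serenity) -/

/-- ★★★ **COLUMN `_16XH25B`** — `_16XH23B` with the serene leaf [SBHSᵇ](1/100, 1/20, 8, 16) replaced by its AMPLITUDE CUT: the MILD leaf [MSBHSᵇ](ϑc = 1/100,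
ϑ = tameRadius, ϑp = 1/10, r = 8, ra = 16, rp = 24) `MildSereneBareHotSparseBPG (1/100) tameRadius (1/10) 8 16 24 dressLevel dressLevel dressExponent 8
collarRadius clusterSize 1 2 (1/16) (1/50)` and the WILD leaf [WHSᵇ](1/10) `HotSparseBPG (1/10) 1 2 (1/16) (1/50)`; [I_D] and [TBISᵇ(8)] kept; 20 generic leaves
+ `PeriodicBulkGapDoor 2` ⇒ `VisibleGap (1/50) ∧ PertRegime (1/50)`.  BOTH new hypotheses are implied by the ones of record (`mildSereneBareHotSparseBPG_of_serene`,
`hotSparseBPG_of_serene_record`, PROVED). [this file, g64] -/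
theorem gap_and_pert_1_50_of_certs_16XH25B (hL : LatticeLiouvilleCert) (hL' : LayeredLiouvilleCert)
    (hR : OscRigidityL2BDPG 1 2 (1 / 16) (1 / 16)) (hX : ExcessFlatnessControlP 1 2 (1 / 16) (1 / 16))
    (hE : ExcessChartLocalisationP 1 2 (1 / 16) (1 / 100)) (hP : RegistrationP 1 2 (1 / 16) (1 / 100))
    (hT : TailDominationCert) (hU : UniformTameStabilityE (1 / 50) 2 (1 / 2000))
    (h1 : WordTransplantP 1 2 (1 / 16) (1 / 100)) (hGT : GradReframingThickP 1 2 (1 / 16) (1 / 100) (1 / 50))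
    (hΛ0 : LaunderingAprioriPX 1 2 (1 / 16) (1 / 100) (1 / 50)) (hΛs : LaunderingStepPX 1 2 (1 / 16) (1 / 100) (1 / 50))
    (hUc : UntwistCollarP 1 2 (1 / 16) (1 / 50))
    (hl : BondIsoLevelsP 1 2 (1 / 16) (1 / 50)) (hN : EnergyNearChartPX 1 2 (1 / 16) (1 / 50) (1 / 2000))
    (hF : TailForceSlavingP 1 2 (1 / 16) (1 / 50))
    (hE' : LipDualLinearisationP 1 2 (1 / 16) (1 / 50)) (hA : L2HarmonicApproxPE 1 2 (1 / 16) (1 / 50) (1 / 2000))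
    (hD : PositionDecayPLE 1 2 (1 / 16) (1 / 50) (1 / 2000)) (hC : PositionCaccioppoliPGE 1 2 (1 / 16) (1 / 50) (1 / 2000))
    (hI : DressedCorePG tameRadius dressLevel dressLevel dressExponent 8 collarRadius clusterSize 1 2 (1 / 16) (1 / 50))
    (hMSBHS : MildSereneBareHotSparseBPG (1 / 100) tameRadius (1 / 10) 8 16 24 dressLevel dressLevel dressExponent 8 collarRadius clusterSize 1 2 (1 / 16) (1 / 50))
    (hWHS : HotSparseBPG (1 / 10) 1 2 (1 / 16) (1 / 50))
    (hTBIS : TameBallIncoherenceSparseBPG (1 / 100) (1 / 200) tameRadius 8 1 2 (1 / 16) (1 / 50))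
    (hG : PeriodicBulkGapDoor 2) : VisibleGap (1 / 50) ∧ PertRegime (1 / 50) :=
  gap_and_pert_1_50_of_certs_16XH23B hL hL' hR hX hE hP hT hU h1 hGT hΛ0 hΛs hUc hl hN hF hE' hA hD hC hI
    (sereneBareHotSparseBPG_of_mild_hot (by norm_num) (by norm_num) hMSBHS hWHS) hTBIS hG

/-- ★★★ **COLUMN `_16XH25BL` (LADDER)** — the twenty generic leaves + [TBISᵇ(8)](1/100, 1/200, tameRadius) (of record) ∧ [TBISᵇ(24)](1/100, 1/200, 1/10)
`TameBallIncoherenceSparseBPG (1/100) (1/200) (1/10) 24 1 2 (1/16) (1/50)` (SIDEWAYS: the (M,K)-ball currency at level `1/10`) ∧ [WHSᵇ](1/10) (WEAKER than the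
record) + `PeriodicBulkGapDoor 2` ⇒ `VisibleGap (1/50) ∧ PertRegime (1/50)`: NO dressing leaf, NO serenity — [HSᵇ](1/20) by the ladder step from [FWSᵇ](1/20,
1/10, 24) ⟸ [TBISᵇ(24)](…, 1/10) and [WHSᵇ](1/10); [ISᵇ₀] by part YE's ball glue; (R_Wᵇ) by part YD. [this file, g64] -/
theorem gap_and_pert_1_50_of_certs_16XH25BL (hL : LatticeLiouvilleCert) (hL' : LayeredLiouvilleCert)
    (hR : OscRigidityL2BDPG 1 2 (1 / 16) (1 / 16)) (hX : ExcessFlatnessControlP 1 2 (1 / 16) (1 / 16))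
    (hE : ExcessChartLocalisationP 1 2 (1 / 16) (1 / 100)) (hP : RegistrationP 1 2 (1 / 16) (1 / 100))
    (hT : TailDominationCert) (hU : UniformTameStabilityE (1 / 50) 2 (1 / 2000))
    (h1 : WordTransplantP 1 2 (1 / 16) (1 / 100)) (hGT : GradReframingThickP 1 2 (1 / 16) (1 / 100) (1 / 50))
    (hΛ0 : LaunderingAprioriPX 1 2 (1 / 16) (1 / 100) (1 / 50)) (hΛs : LaunderingStepPX 1 2 (1 / 16) (1 / 100) (1 / 50))
    (hUc : UntwistCollarP 1 2 (1 / 16) (1 / 50))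
    (hl : BondIsoLevelsP 1 2 (1 / 16) (1 / 50)) (hN : EnergyNearChartPX 1 2 (1 / 16) (1 / 50) (1 / 2000))
    (hF : TailForceSlavingP 1 2 (1 / 16) (1 / 50))
    (hE' : LipDualLinearisationP 1 2 (1 / 16) (1 / 50)) (hA : L2HarmonicApproxPE 1 2 (1 / 16) (1 / 50) (1 / 2000))
    (hD : PositionDecayPLE 1 2 (1 / 16) (1 / 50) (1 / 2000)) (hC : PositionCaccioppoliPGE 1 2 (1 / 16) (1 / 50) (1 / 2000))
    (hTBIS : TameBallIncoherenceSparseBPG (1 / 100) (1 / 200) tameRadius 8 1 2 (1 / 16) (1 / 50))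
    (hTBIS' : TameBallIncoherenceSparseBPG (1 / 100) (1 / 200) (1 / 10) 24 1 2 (1 / 16) (1 / 50))
    (hWHS : HotSparseBPG (1 / 10) 1 2 (1 / 16) (1 / 50))
    (hG : PeriodicBulkGapDoor 2) : VisibleGap (1 / 50) ∧ PertRegime (1 / 50) :=
  gap_and_pert_1_50_of_certs_16XH18B_tol hL hL' hR hX hE hP hT hU h1 hGT hΛ0 hΛs hUc (untwistBookkeepingP_one 2 (1 / 50)) hl hN hF hE' hA hD hC
    (wildFractionBPG_of_sparse₀ (by norm_num [tameRadius])
      (incoherenceSparseBPG₀_of_hot_tameBallIncoherent (by norm_num) (by norm_num)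
        (hotSparseBPG_of_farWarm_hot (by norm_num) (by norm_num) (farWarmSparseBPG_of_tameBallIncoherence (by norm_num [tameRadius]) hTBIS') hWHS) hTBIS))
    hG

/-- **THE RECORD ⇒ THE CONSERVATIVE DOCKET (PROVED)**: [I_D] ∧ [SBHSᵇ] ∧ [TBISᵇ(8)] of `_16XH23B` give [MSBHSᵇ](…, 1/10, …, 24) ∧ [WHSᵇ](1/10). [this file, g64] -/
theorem mild_and_wild_of_record_16XH23B
    (hI : DressedCorePG tameRadius dressLevel dressLevel dressExponent 8 collarRadius clusterSize 1 2 (1 / 16) (1 / 50))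
    (hSBHS : SereneBareHotSparseBPG (1 / 100) tameRadius 8 16 dressLevel dressLevel dressExponent 8 collarRadius clusterSize 1 2 (1 / 16) (1 / 50))
    (hTBIS : TameBallIncoherenceSparseBPG (1 / 100) (1 / 200) tameRadius 8 1 2 (1 / 16) (1 / 50)) :
    MildSereneBareHotSparseBPG (1 / 100) tameRadius (1 / 10) 8 16 24 dressLevel dressLevel dressExponent 8 collarRadius clusterSize 1 2 (1 / 16) (1 / 50)
      ∧ HotSparseBPG (1 / 10) 1 2 (1 / 16) (1 / 50) :=
  ⟨mildSereneBareHotSparseBPG_of_serene hSBHS,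
    hotSparseBPG_of_serene_record (by norm_num) (by norm_num) le_rfl (by norm_num [tameRadius]) hI hSBHS hTBIS⟩

end Summit.AtomisticToContinuum.Crystallization.Theorems.ChartedZeroExcessLayeredLatticeLiouville
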